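import Summits.Ventures.PercRepro.C026PFunCycleDefs
import Summits.Ventures.PercRepro.C026PFunStar
import Summits.Ventures.PercRepro.C026PFunMono
import Summits.Ventures.PercRepro.C026PFunSlack

/-!
# A1: the configuration sum of the cycle in mine-3's explicit form (p6, gen 16; SEMANTICS-SPEC A1)

With the arcs `cycleArcs ω` (the pendant vertices of the probe's component) and the pieces
`cyclePieces ω` (the runs away from the probe) as explicit finsets of indices, the (P) functional of
the cycle is mine-3's configuration sum `cycleSum`:
`∑_S [(1 − 2Z_A A(S))·N(S) + K_A·M(S)·(2 − Z_A A(S^c))·N(S^c)]`, `A = ∏_{Γ} x`, `M = ∏_{Γ} K`,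
`N = ∏_{pieces}(2 − X_R)` (`pFun_cycle_eq`) — the left-hand side of the SEMANTICS LEMMA A3 in the
cell's own vocabulary.
-/

namespace PercRepro

namespace MultiGraph

open Finset

variable {k : ℕ}

/-! ### The clusters of the cycle as explicit finsets (SEMANTICS-SPEC A1) -/

open Classical in
/-- `Γ(ω)`: the pendant vertices of the probe's component (the two arcs), as a finset of indices. -/
noncomputable def cycleArcs (ω : Config (Fin (k + 1))) : Finset (Fin k) :=
  univ.filter fun i => RightArc ω i ∨ LeftArc ω i

open Classical in
/-- The piece of `v_{i+1}`: the run of pendant vertices joined to it by open path edges. -/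
noncomputable def cyclePiece (ω : Config (Fin (k + 1))) (i : Fin k) : Finset (Fin k) :=
  univ.filter fun j => Run ω i j ∨ Run ω j i

/-- The probe's cluster: the probe and the arcs. -/
theorem cycle_clusterF_none (ω : Config (Fin (k + 1))) :
    (cycle k).clusterF ω none = insert none ((cycleArcs ω).map (someEmb (Fin k))) := by
  ext u
  rw [mem_clusterF, Finset.mem_insert, Finset.mem_map]
  cases u with
  | none => simp [Conn.refl]
  | some i =>
    simp only [reduceCtorEq, false_or, someEmb, Function.Embedding.coeFn_mk, Option.some.injEq,
      exists_eq_right, cycleArcs, Finset.mem_filter, Finset.mem_univ, true_and]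
    exact cycle_conn_none_iff ω i

/-- The cluster of a pendant vertex away from the probe: its piece. -/
theorem cycle_clusterF_some {ω : Config (Fin (k + 1))} {i : Fin k} (hi : i ∉ cycleArcs ω) :
    (cycle k).clusterF ω (some i) = (cyclePiece ω i).map (someEmb (Fin k)) := by
  have hi' : ¬ (cycle k).Conn ω none (some i) := by
    rw [cycle_conn_none_iff]
    simpa [cycleArcs] using hi
  ext u
  rw [mem_clusterF, Finset.mem_map]
  cases u with
  | none =>
    simp only [someEmb, Function.Embedding.coeFn_mk, reduceCtorEq, and_false, exists_false,
      iff_false]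
    exact fun h => hi' h.symm
  | some j =>
    simp only [someEmb, Function.Embedding.coeFn_mk, Option.some.injEq, exists_eq_right,
      cyclePiece, Finset.mem_filter, Finset.mem_univ, true_and]
    exact cycle_conn_some_iff hi' j


/-! ### A1: the configuration sum of the cycle in mine-3's explicit form -/

open Classical in
/-- The pieces of `ω`: the runs of the pendant vertices away from the probe, as a finset of finsets. -/
noncomputable def cyclePieces (ω : Config (Fin (k + 1))) : Finset (Finset (Fin k)) :=
  (univ.filter fun i => i ∉ cycleArcs ω).image (cyclePiece ω)

/-- The embedding `P ↦ P.map some` of finsets of indices into finsets of vertices. -/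
def mapSomeEmb (k : ℕ) : Finset (Fin k) ↪ Finset (Option (Fin k)) :=
  ⟨fun P => P.map (someEmb (Fin k)), Finset.map_injective _⟩

/-- The embedding, pointwise. -/
theorem mapSomeEmb_apply (P : Finset (Fin k)) : mapSomeEmb k P = P.map (someEmb (Fin k)) := rfl

variable (x K : Option (Fin k) → ℝ)

/-- `Z_A·A(S) = X_c(S)`: the `x`-product over the probe's component. -/
theorem cycle_xCluster (ω : Config (Fin (k + 1))) :
    (cycle k).xCluster x none ω = x none * ∏ i ∈ cycleArcs ω, x (some i) := by
  unfold xCluster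
  rw [cycle_clusterF_none, Finset.prod_insert (none_notMem_map_someEmb _), Finset.prod_map]
  rfl

/-- `K_A·M(S) = K_c(S)`. -/
theorem cycle_kCluster (ω : Config (Fin (k + 1))) :
    (cycle k).kCluster K none ω = K none * ∏ i ∈ cycleArcs ω, K (some i) := by
  unfold kCluster
  rw [cycle_clusterF_none, Finset.prod_insert (none_notMem_map_someEmb _), Finset.prod_map]
  rfl

/-- The clusters of the cycle: the probe's cluster and the pieces (mapped into the vertex type). -/
theorem cycle_clusters (ω : Config (Fin (k + 1))) :
    (cycle k).clusters ω =
      insert ((cycle k).clusterF ω none) ((cyclePieces ω).map (mapSomeEmb k)) := by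
  ext R
  rw [mem_clusters, Finset.mem_insert, Finset.mem_map]
  constructor
  · rintro ⟨u, rfl⟩
    cases u with
    | none => exact Or.inl rfl
    | some i =>
      by_cases hi : i ∈ cycleArcs ω
      · exact Or.inl (clusterF_eq_of_conn ((cycle_conn_none_iff ω i).2
          (by simpa [cycleArcs] using hi)).symm)
      · refine Or.inr ⟨cyclePiece ω i, ?_, ?_⟩
        · unfold cyclePieces
          exact Finset.mem_image_of_mem _ (Finset.mem_filter.2 ⟨Finset.mem_univ _, hi⟩)
        · rw [cycle_clusterF_some hi]
          rfl
  · rintro (rfl | ⟨P, hP, rfl⟩)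
    · exact ⟨none, rfl⟩
    · unfold cyclePieces at hP
      obtain ⟨i, hi, rfl⟩ := Finset.mem_image.1 hP
      have hi' : i ∉ cycleArcs ω := (Finset.mem_filter.1 hi).2
      exact ⟨some i, by rw [cycle_clusterF_some hi']; rfl⟩

/-- The probe's cluster is not a (mapped) piece. -/
theorem cycle_clusterF_none_notMem (ω : Config (Fin (k + 1))) :
    (cycle k).clusterF ω none ∉ (cyclePieces ω).map (mapSomeEmb k) := by
  rw [Finset.mem_map]
  rintro ⟨P, _, hP⟩
  have : (none : Option (Fin k)) ∈ (cycle k).clusterF ω none := self_mem_clusterF ω none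
  rw [← hP, mapSomeEmb_apply] at this
  exact none_notMem_map_someEmb P this

/-- `N(S)`: the product of `2 − X_R` over the pieces. -/
theorem cycle_nbarOff (ω : Config (Fin (k + 1))) :
    (cycle k).nbarOff x none ω = ∏ P ∈ cyclePieces ω, (2 - ∏ i ∈ P, x (some i)) := by
  unfold nbarOff
  rw [cycle_clusters, Finset.erase_insert (cycle_clusterF_none_notMem ω), Finset.prod_map]
  refine Finset.prod_congr rfl fun P _ => ?_
  rw [mapSomeEmb_apply, Finset.prod_map]
  rfl

/-- **A1 — the configuration sum of the cycle (SEMANTICS-SPEC A1)**: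
`∑_S [(1 − 2Z_A A(S))·N(S) + K_A·M(S)·(2 − Z_A A(S^c))·N(S^c)]` with `A(S) = ∏_{Γ} x`,
`M(S) = ∏_{Γ} K`, `N(S) = ∏_{pieces}(2 − X_R)`, `S^c` the complementary configuration. -/
noncomputable def cycleSum : ℝ :=
  ∑ ω : Config (Fin (k + 1)),
    ((1 - 2 * (x none * ∏ i ∈ cycleArcs ω, x (some i))) *
        ∏ P ∈ cyclePieces ω, (2 - ∏ i ∈ P, x (some i)) +
      K none * (∏ i ∈ cycleArcs ω, K (some i)) *
        ((2 - x none * ∏ i ∈ cycleArcs (fun e => !ω e), x (some i)) *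
          ∏ P ∈ cyclePieces (fun e => !ω e), (2 - ∏ i ∈ P, x (some i))))

/-- **`pFun` on the cycle is A1.** -/
theorem pFun_cycle_eq : (cycle k).pFun none x K univ = cycleSum x K := by
  unfold pFun cycleSum
  rw [configsIn_univ]
  refine Finset.sum_congr rfl fun ω _ => ?_
  rw [complIn_univ, cycle_nbarOff, cycle_xCluster, cycle_kCluster, nbar_eq_mul_nbarOff _ x none,
    cycle_nbarOff, cycle_xCluster]
  ring


/-! ### The doubled edge `C₁` (mine-3 §28 (f)) -/

/-- The arcs of the doubled edge `C₁`: `v₁` is on an arc iff `e₀` or `e₁` is open. -/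
theorem cycleArcs_one (ω : Config (Fin 2)) :
    cycleArcs (k := 1) ω = if ω 0 = true ∨ ω 1 = true then {0} else ∅ := by
  ext i
  have hi : i = 0 := Fin.ext (by omega)
  subst hi
  simp only [cycleArcs, Finset.mem_filter, Finset.mem_univ, true_and, RightArc, LeftArc]
  by_cases h0 : ω 0 = true <;> by_cases h1 : ω 1 = true <;> simp [h0, h1, Fin.forall_fin_two]



/-- The piece of `v₁` in `C₁` is `{0}`. -/
theorem cyclePiece_one (ω : Config (Fin 2)) : cyclePiece (k := 1) ω 0 = {0} := by
  ext i
  have hi : i = 0 := Fin.ext (by omega)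
  subst hi
  simp [cyclePiece, Run]

/-- The pieces of `C₁`: `{{0}}` when both edges are closed, none otherwise. -/
theorem cyclePieces_one (ω : Config (Fin 2)) :
    cyclePieces (k := 1) ω = if ω 0 = true ∨ ω 1 = true then ∅ else {{0}} := by
  unfold cyclePieces
  rw [cycleArcs_one]
  by_cases h : ω 0 = true ∨ ω 1 = true
  · rw [if_pos h, if_pos h]
    apply Finset.image_eq_empty.2
    ext i
    have hi : i = 0 := Fin.ext (by omega)
    subst hi
    simp
  · rw [if_neg h, if_neg h]
    ext P
    simp only [Finset.mem_image, Finset.mem_filter, Finset.mem_univ, Finset.notMem_empty,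
      not_false_eq_true, and_true, true_and, Finset.mem_singleton]
    constructor
    · rintro ⟨i, rfl⟩
      have hi : i = 0 := Fin.ext (by omega)
      subst hi
      exact cyclePiece_one ω
    · rintro rfl
      exact ⟨0, cyclePiece_one ω⟩

/-- **The doubled edge `C₁` (mine-3 §28 (f))**:
`(P_{C₁,A}) = (2 − x₁)(1 − 2Z_A) + 3(1 − 2Z_Ax₁) + K_A(2 − Z_Ax₁) + K_AK₁[2(2 − Z_Ax₁) + (2 − x₁)(2 − Z_A)]`. -/
theorem cycleSum_one (x K : Option (Fin 1) → ℝ) :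
    cycleSum (k := 1) x K =
      (2 - x (some 0)) * (1 - 2 * x none) + 3 * (1 - 2 * x none * x (some 0)) +
        K none * (2 - x none * x (some 0)) +
        K none * K (some 0) * (2 * (2 - x none * x (some 0)) + (2 - x (some 0)) * (2 - x none)) := by
  unfold cycleSum
  rw [← (finTwoArrowEquiv Bool).symm.sum_comp, Fintype.sum_prod_type]
  simp only [Fintype.sum_bool, finTwoArrowEquiv_symm_apply]
  have e0 : ∀ (a b : Bool), (![a, b] : Fin 2 → Bool) 0 = a := fun a b => rfl
  have e1 : ∀ (a b : Bool), (![a, b] : Fin 2 → Bool) 1 = b := fun a b => rfl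
  have ec : ∀ (a b : Bool), (fun e => !(![a, b] : Fin 2 → Bool) e) = ![!a, !b] := fun a b => by
    funext e
    fin_cases e <;> rfl
  simp only [ec, cycleArcs_one, cyclePieces_one, e0, e1, Bool.not_true, Bool.not_false]
  simp
  ring


/-- **(P) ≥ 0 on the doubled edge `C₁`** at every band state (THEOREM C for `k = 1`, by hand). -/
theorem pFun_cycle_one_nonneg {x K : Option (Fin 1) → ℝ} (hx : ∀ v, 0 ≤ x v ∧ x v ≤ 1)
    (hK : ∀ v, kMin (x v) ≤ K v) : 0 ≤ (cycle 1).pFun none x K univ := by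
  refine pFun_nonneg_of_corner (fun x hx => ?_) hx hK
  rw [pFun_cycle_eq, cycleSum_one]
  have hZ := hx none
  have h1 := hx (some 0)
  set Z := x none with hZdef
  set y := x (some 0) with hydef
  rcases le_or_gt Z (1 / 2) with hZh | hZh <;> rcases le_or_gt y (1 / 2) with hyh | hyh
  · rw [kMin_eq_zero_of_le hZh, kMin_eq_zero_of_le hyh]
    nlinarith [mul_nonneg (by linarith : (0:ℝ) ≤ 2 - y) (by linarith : (0:ℝ) ≤ 1 - 2 * Z),
      mul_nonneg hZ.1 h1.1]
  · rw [kMin_eq_zero_of_le hZh]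
    have hk1 := kMin_nonneg y
    have hZy : Z * y ≤ Z := mul_le_of_le_one_right hZ.1 h1.2
    nlinarith [mul_nonneg (by linarith : (0:ℝ) ≤ 2 - y) (by linarith : (0:ℝ) ≤ 1 - 2 * Z),
      mul_nonneg hZ.1 h1.1, mul_nonneg hk1 (by linarith : (0:ℝ) ≤ 1 - 2 * Z * y)]
  · rw [kMin_eq_zero_of_le hyh, kMin_eq_of_half_le hZh.le hZ.2]
    have h2Z : 0 < 2 - Z := by linarith
    have key : 0 ≤ (2 - Z) * ((2 - y) * (1 - 2 * Z) + 3 * (1 - 2 * Z * y)) + (2 * Z - 1) * (2 - Z * y) := by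
      nlinarith [mul_nonneg (sub_nonneg.2 hZ.2) (sub_nonneg.2 h1.2), mul_nonneg hZ.1 h1.1,
        mul_nonneg (sub_nonneg.2 hZ.2) h1.1, mul_nonneg (by linarith : (0:ℝ) ≤ 1 - 2 * y) hZ.1,
        mul_nonneg (by linarith : (0:ℝ) ≤ 1 - 2 * y) (sub_nonneg.2 hZ.2),
        mul_nonneg (mul_nonneg (sub_nonneg.2 hZ.2) (sub_nonneg.2 hZ.2)) h1.1]
    have : (2 - y) * (1 - 2 * Z) + 3 * (1 - 2 * Z * y) + (2 * Z - 1) / (2 - Z) * (2 - Z * y) +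
        (2 * Z - 1) / (2 - Z) * 0 * (2 * (2 - Z * y) + (2 - y) * (2 - Z)) =
        ((2 - Z) * ((2 - y) * (1 - 2 * Z) + 3 * (1 - 2 * Z * y)) + (2 * Z - 1) * (2 - Z * y)) / (2 - Z) := by
      field_simp
      ring
    rw [this]
    exact div_nonneg key h2Z.le
  · rw [kMin_eq_of_half_le hyh.le h1.2, kMin_eq_of_half_le hZh.le hZ.2]
    have h2Z : 0 < 2 - Z := by linarith
    have h2y : 0 < 2 - y := by linarith
    have key : 0 ≤ (2 - Z) * (2 - y) * ((2 - y) * (1 - 2 * Z) + 3 * (1 - 2 * Z * y)) +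
        (2 * Z - 1) * (2 - y) * (2 - Z * y) +
        (2 * Z - 1) * (2 * y - 1) * (2 * (2 - Z * y) + (2 - y) * (2 - Z)) := by
      nlinarith [mul_nonneg (sub_nonneg.2 hZ.2) (sub_nonneg.2 h1.2), mul_nonneg hZ.1 h1.1,
        mul_nonneg (by linarith : (0:ℝ) ≤ 2 * Z - 1) (by linarith : (0:ℝ) ≤ 2 * y - 1),
        mul_nonneg (mul_nonneg (sub_nonneg.2 hZ.2) (sub_nonneg.2 h1.2)) (by linarith : (0:ℝ) ≤ 2 * Z - 1),
        mul_nonneg (mul_nonneg (sub_nonneg.2 hZ.2) (sub_nonneg.2 h1.2)) (by linarith : (0:ℝ) ≤ 2 * y - 1),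
        mul_nonneg (mul_nonneg (sub_nonneg.2 hZ.2) (sub_nonneg.2 hZ.2)) (sub_nonneg.2 h1.2),
        mul_nonneg (mul_nonneg (sub_nonneg.2 h1.2) (sub_nonneg.2 h1.2)) (sub_nonneg.2 hZ.2)]
    have : (2 - y) * (1 - 2 * Z) + 3 * (1 - 2 * Z * y) + (2 * Z - 1) / (2 - Z) * (2 - Z * y) +
        (2 * Z - 1) / (2 - Z) * ((2 * y - 1) / (2 - y)) * (2 * (2 - Z * y) + (2 - y) * (2 - Z)) =
        ((2 - Z) * (2 - y) * ((2 - y) * (1 - 2 * Z) + 3 * (1 - 2 * Z * y)) +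
          (2 * Z - 1) * (2 - y) * (2 - Z * y) +
          (2 * Z - 1) * (2 * y - 1) * (2 * (2 - Z * y) + (2 - y) * (2 - Z))) / ((2 - Z) * (2 - y)) := by
      field_simp
    rw [this]
    exact div_nonneg key (mul_pos h2Z h2y).le


/-- **The base case of mine-3's cycle induction (§28 (f))**: `(P_{C₁,A}) − Corr₂ ≥ 0` at every band
state, `Corr₂ = 2(1 − K₁K_A)(1 − x₁)(1 − Z_A)`. -/
theorem cycle_one_sub_corr_nonneg {x K : Option (Fin 1) → ℝ} (hx : ∀ v, 0 ≤ x v ∧ x v ≤ 1)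
    (hK : ∀ v, kMin (x v) ≤ K v) :
    0 ≤ (cycle 1).pFun none x K univ -
      2 * (1 - K (some 0) * K none) * (1 - x (some 0)) * (1 - x none) := by
  -- the difference is nondecreasing in both `K`'s (the `K`-coefficients of `(P_{C₁})` dominate those of `Corr₂`)
  rw [pFun_cycle_eq, cycleSum_one]
  have hZ := hx none
  have h1 := hx (some 0)
  have hkZ := hK none
  have hk1 := hK (some 0)
  set Z := x none
  set y := x (some 0)
  set KA := K none
  set K1 := K (some 0)
  have hKA0 : 0 ≤ KA := (kMin_nonneg _).trans hkZ
  have hK10 : 0 ≤ K1 := (kMin_nonneg _).trans hk1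
  -- reduce to the corners `KA = kMin Z`, `K1 = kMin y`: the expression is affine nondecreasing in each
  have mono : ∀ a b : ℝ, kMin Z ≤ a → kMin y ≤ b →
      (2 - y) * (1 - 2 * Z) + 3 * (1 - 2 * Z * y) + kMin Z * (2 - Z * y) +
        kMin Z * kMin y * (2 * (2 - Z * y) + (2 - y) * (2 - Z)) -
        2 * (1 - kMin y * kMin Z) * (1 - y) * (1 - Z) ≤
      (2 - y) * (1 - 2 * Z) + 3 * (1 - 2 * Z * y) + a * (2 - Z * y) +
        a * b * (2 * (2 - Z * y) + (2 - y) * (2 - Z)) - 2 * (1 - b * a) * (1 - y) * (1 - Z) := by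
    intro a b ha hb
    have hk0 := kMin_nonneg Z
    have hk0' := kMin_nonneg y
    nlinarith [mul_nonneg (sub_nonneg.2 ha) (sub_nonneg.2 hZ.2), mul_nonneg (sub_nonneg.2 ha) (sub_nonneg.2 h1.2),
      mul_nonneg (sub_nonneg.2 hb) (sub_nonneg.2 ha), mul_nonneg hk0 (sub_nonneg.2 hb),
      mul_nonneg (mul_nonneg (sub_nonneg.2 ha) (sub_nonneg.2 hb)) (mul_nonneg (sub_nonneg.2 hZ.2) (sub_nonneg.2 h1.2)),
      mul_nonneg hk0' (sub_nonneg.2 ha), mul_nonneg (sub_nonneg.2 ha) (mul_nonneg hZ.1 h1.1),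
      mul_nonneg (mul_nonneg hk0 (sub_nonneg.2 hb)) (mul_nonneg (sub_nonneg.2 hZ.2) (sub_nonneg.2 h1.2)),
      mul_nonneg (mul_nonneg hk0' (sub_nonneg.2 ha)) (mul_nonneg (sub_nonneg.2 hZ.2) (sub_nonneg.2 h1.2)),
      mul_nonneg (sub_nonneg.2 ha) (mul_nonneg (sub_nonneg.2 hZ.2) (sub_nonneg.2 h1.2)),
      mul_nonneg hk0 (mul_nonneg (sub_nonneg.2 hb) (sub_nonneg.2 h1.2))]
  refine le_trans ?_ (mono KA K1 hkZ hk1)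
  rcases le_or_gt Z (1 / 2) with hZh | hZh <;> rcases le_or_gt y (1 / 2) with hyh | hyh
  · rw [kMin_eq_zero_of_le hZh, kMin_eq_zero_of_le hyh]
    nlinarith [mul_nonneg hZ.1 h1.1, mul_nonneg (by linarith : (0:ℝ) ≤ 1 - 2 * Z) h1.1]
  · rw [kMin_eq_zero_of_le hZh]
    nlinarith [mul_nonneg hZ.1 h1.1, mul_nonneg (by linarith : (0:ℝ) ≤ 1 - 2 * Z) (sub_nonneg.2 h1.2),
      mul_nonneg (by linarith : (0:ℝ) ≤ 1 - 2 * Z) h1.1]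
  · rw [kMin_eq_zero_of_le hyh, kMin_eq_of_half_le hZh.le hZ.2]
    have h2Z : 0 < 2 - Z := by linarith
    have key : 0 ≤ (2 - Z) * ((2 - y) * (1 - 2 * Z) + 3 * (1 - 2 * Z * y) - 2 * (1 - y) * (1 - Z)) +
        (2 * Z - 1) * (2 - Z * y) := by
      nlinarith [mul_nonneg (sub_nonneg.2 hZ.2) (sub_nonneg.2 h1.2), mul_nonneg hZ.1 h1.1,
        mul_nonneg (sub_nonneg.2 hZ.2) h1.1, mul_nonneg (by linarith : (0:ℝ) ≤ 1 - 2 * y) hZ.1,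
        mul_nonneg (by linarith : (0:ℝ) ≤ 1 - 2 * y) (sub_nonneg.2 hZ.2),
        mul_nonneg (mul_nonneg (sub_nonneg.2 hZ.2) (sub_nonneg.2 hZ.2)) h1.1,
        mul_nonneg (mul_nonneg (sub_nonneg.2 hZ.2) (by linarith : (0:ℝ) ≤ 1 - 2 * y)) (by linarith : (0:ℝ) ≤ 2 * Z - 1)]
    have : (2 - y) * (1 - 2 * Z) + 3 * (1 - 2 * Z * y) + (2 * Z - 1) / (2 - Z) * (2 - Z * y) +
        (2 * Z - 1) / (2 - Z) * 0 * (2 * (2 - Z * y) + (2 - y) * (2 - Z)) -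
        2 * (1 - 0 * ((2 * Z - 1) / (2 - Z))) * (1 - y) * (1 - Z) =
        ((2 - Z) * ((2 - y) * (1 - 2 * Z) + 3 * (1 - 2 * Z * y) - 2 * (1 - y) * (1 - Z)) +
          (2 * Z - 1) * (2 - Z * y)) / (2 - Z) := by
      field_simp
      ring
    rw [this]
    exact div_nonneg key h2Z.le
  · rw [kMin_eq_of_half_le hyh.le h1.2, kMin_eq_of_half_le hZh.le hZ.2]
    have h2Z : 0 < 2 - Z := by linarith
    have h2y : 0 < 2 - y := by linarith
    have key : 0 ≤ (2 - Z) * (2 - y) * ((2 - y) * (1 - 2 * Z) + 3 * (1 - 2 * Z * y)) +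
        (2 * Z - 1) * (2 - y) * (2 - Z * y) +
        (2 * Z - 1) * (2 * y - 1) * (2 * (2 - Z * y) + (2 - y) * (2 - Z)) -
        2 * ((2 - Z) * (2 - y) - (2 * y - 1) * (2 * Z - 1)) * (1 - y) * (1 - Z) := by
      nlinarith [mul_nonneg (sub_nonneg.2 hZ.2) (sub_nonneg.2 h1.2), mul_nonneg hZ.1 h1.1,
        mul_nonneg (by linarith : (0:ℝ) ≤ 2 * Z - 1) (by linarith : (0:ℝ) ≤ 2 * y - 1),
        mul_nonneg (mul_nonneg (sub_nonneg.2 hZ.2) (sub_nonneg.2 h1.2)) (by linarith : (0:ℝ) ≤ 2 * Z - 1),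
        mul_nonneg (mul_nonneg (sub_nonneg.2 hZ.2) (sub_nonneg.2 h1.2)) (by linarith : (0:ℝ) ≤ 2 * y - 1),
        mul_nonneg (mul_nonneg (sub_nonneg.2 hZ.2) (sub_nonneg.2 hZ.2)) (sub_nonneg.2 h1.2),
        mul_nonneg (mul_nonneg (sub_nonneg.2 h1.2) (sub_nonneg.2 h1.2)) (sub_nonneg.2 hZ.2),
        mul_nonneg (mul_nonneg (sub_nonneg.2 hZ.2) (sub_nonneg.2 h1.2)) (mul_nonneg (sub_nonneg.2 hZ.2) (sub_nonneg.2 h1.2))]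
    have : (2 - y) * (1 - 2 * Z) + 3 * (1 - 2 * Z * y) + (2 * Z - 1) / (2 - Z) * (2 - Z * y) +
        (2 * Z - 1) / (2 - Z) * ((2 * y - 1) / (2 - y)) * (2 * (2 - Z * y) + (2 - y) * (2 - Z)) -
        2 * (1 - (2 * y - 1) / (2 - y) * ((2 * Z - 1) / (2 - Z))) * (1 - y) * (1 - Z) =
        ((2 - Z) * (2 - y) * ((2 - y) * (1 - 2 * Z) + 3 * (1 - 2 * Z * y)) +
          (2 * Z - 1) * (2 - y) * (2 - Z * y) +
          (2 * Z - 1) * (2 * y - 1) * (2 * (2 - Z * y) + (2 - y) * (2 - Z)) -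
          2 * ((2 - Z) * (2 - y) - (2 * y - 1) * (2 * Z - 1)) * (1 - y) * (1 - Z)) / ((2 - Z) * (2 - y)) := by
      field_simp
    rw [this]
    exact div_nonneg key (mul_pos h2Z h2y).le


end MultiGraph

end PercRepro
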